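import Literature.Geometry.Riemannian.AlmostNonnegRicciFibrationLimitGroup
import Literature.Geometry.MetricGeometry.PointedEquivariantGHLimit
import HarnessLib

/-!
# Huang–Huang–Wang–Zhu 2026, Main Theorem 1 at `n = 4`, `b₁ = 1`: equivariant convergence of the
covers of a contradiction sequence with their deck groups

Ninth reduction file for the named fact
`Literature.Geometry.Riemannian.huangHuangWangZhu2026_fibresOverCircle_four`. Huang–Huang–Wang–Zhu
2026, §4 p. 13: "Up to passing to a subsequence, we consider the following commutative diagram
(4.1): `(M̂ᵢ, p̂ᵢ, Hᵢ) →_GH (ℝˢ × Ŷ, (0ˢ, ŷ_∞), H)`" — pointed EQUIVARIANT Gromov–Hausdorff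
convergence of the covers with their deck groups `Hᵢ ≅ ℤ` (Thm 2.1, §2.1 p. 6). With the tree's
pointed Fukaya–Yamaguchi theorem (`MetricGeometry/PointedEquivariantGHLimit.lean`) this file records
the statement for a contradiction sequence `D : (i : ℕ) → CoreDatum κ (δ i)` with base points `p̂ᵢ`,
under the explicit covering-bound hypothesis `hcov` of
`AlmostNonnegRicciFibrationPrecompact.lean` (Bishop–Gromov, not in the tree):

* `CoreDatum.exists_strictMono_pointedEquivGHConv` — **a subsequence `(M̂_{φ n}, p̂_{φ n}, H_{φ n})`
  converges in the pointed equivariant Gromov–Hausdorff sense (`PointedEquivGHConv`) to the proper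
  ultralimit `Y` with the abelian, cocompact-at-scale-`1` limit group `H = deckLimitGroup D p̂`**
  (`AlmostNonnegRicciFibrationLimitGroup.lean`).

Proved theorems only; no named facts; (E) untouched.

## References

* H. Huang, X.-T. Huang, J. Wang, X. Zhu, arXiv:2605.24380 (2026), §2.1 p. 6 (Thm 2.1), §4 p. 13
  (diagram (4.1)). [HuangHuangWangZhu2026]
-/

noncomputable section

open scoped Manifold ContDiff Topology
open Function Set Filter Metric

namespace Literature.Geometry.Riemannian

open Literature.Geometry.MetricGeometry Literature.Topology.FourManifolds.CircleMaps

namespace CoreDatum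

variable {κ : ℝ} {δ : ℕ → ℝ} (D : (i : ℕ) → CoreDatum κ (δ i)) (p : ∀ i, (D i).Cover)

/-- **Diagram (4.1), existence of the equivariant limit** (Huang–Huang–Wang–Zhu 2026, §4 p. 13 with
Thm 2.1): given uniform covering bounds for the balls of the covers, a subsequence of
`(M̂ᵢ, p̂ᵢ, Hᵢ)` — the covers of the data with their base points and deck groups
`Multiplicative ℤ` — converges in the pointed equivariant Gromov–Hausdorff sense to the proper
ultralimit (along the hyperfilter) with the limit group `deckLimitGroup D p̂`, which is abelian
(`deckLimitGroup_mul_comm`) and moves every point into the unit ball about the base point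
(`exists_mem_deckLimitGroup_dist_basePt_le_one`). [cite: HuangHuangWangZhu2026, §2.1 p. 6 Thm 2.1 and §4 p. 13] -/
theorem exists_strictMono_pointedEquivGHConv
    (hcov : letI := coverMetricSpaces D
      ∀ (R ε : ℝ), 0 < ε → ∃ N : ℕ, ∀ i, ∃ S : Finset ((D i).Cover), S.card ≤ N ∧
        ∀ x ∈ closedBall (p i) R, ∃ s ∈ S, dist x s ≤ ε) :
    letI := coverMetricSpaces D
    ProperSpace (Ultralimit p (hyperfilter ℕ)) ∧
      ∃ φ : ℕ → ℕ, StrictMono φ ∧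
        PointedEquivGHConv (X := fun n ↦ (D (φ n)).Cover) (fun _ ↦ Multiplicative ℤ)
          (deckLimitGroup D p) (fun n ↦ p (φ n)) (Ultralimit.basePt p (hyperfilter ℕ)) := by
  letI := coverMetricSpaces D
  haveI := isIsometricVAdd_covers D
  exact Ultralimit.exists_strictMono_pointedEquivGHConv_hyperfilter (Γ := fun _ ↦ Multiplicative ℤ)
    hcov

end CoreDatum

end Literature.Geometry.Riemannian
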